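import Literature.Probability.FitznerVanDerHofstad2017.Stage1CellsRec
import HarnessLib

/-!
# Literature.Probability.FitznerVanDerHofstad2017.Stage1CellsU — the repulsive-polygon cells with the DERIVABLE multiplicities (LEMMAS §21, node N72(b)) and their dependents

CITATION HEADER (PLACEMENT v2). Part of the certified REPRODUCTION of R. Fitzner, R. van der Hofstad, *Mean-field
behavior for nearest-neighbor percolation in d > 10*, EJP 22 (2017) no. 43 [FvdH17] (notebook `Percolation.nb`) and
*Generalized approach to the non-backtracking lace expansion*, PTRF 169 (2017) 1041–1119 [NoBLE17]; build `lace`, seat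
lean2 (gen 13), LEMMAS §21 node N72(b) TRANCHE 1 (the cell TEXT; the ℚ mirror, the `N ≥ 4` tails over these cells and
the re-decided `d = 11` dominations are tranches 2–3).  ADDITIVE companion of `Stage1Cells.lean` / `Stage1CellsRec.lean`:
nothing there is changed (the notebook transcription stays the faithful quotation it is), no numeral of the notebooks, no
table, no theorem about a lattice quantity, nothing here is a cited fact — pure `PX` syntax like `Stage1Cells`.

WHAT THIS MODULE IS.  `Stage1Cells.lean` transcribes `Percolation.nb` cells 11–12 (`Bound[Triangle|Square,m,s]`,
`Bound[OpenTriangle|OpenSquare,m,s]`) AS CODED.  HOME/LEMMAS.md §21 (DIVERGENCE D57 = num3 D27 (a)(b), REFEREE R242,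
R-D57, R-D57b; carver's N72(b) SPEC) records, per repulsive-polygon cell, the multiplicity table for which the diagrammatic
bound is DERIVABLE by the printed method of [NoBLE17-I] §5.3 ((5.40)–(5.42), first form of (5.41)): with `n := R − m`
(`R = RSteps`) the closed Triangle ONE-tail count is `C(n+1,2)` (the notebook codes `C(n,2)`), the closed Square TWO-tail
count is `C(n+1,2)` (coded `C(n,2)`); the two coded over-counts (Triangle two-tail `R+1−m`, Square one-tail `C(R+3−m,3)`)
are KEPT, exactly as the engines' runs of record do (class `U` = `tri1 + sq2`, REFEREE R248: this reproduces all fourteen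
`Bound[Triangle|Square,m,s]` cells of engine B's record run).  For the OPEN cells the module takes the ADDITIVE form —
DIVERGENCE D12: the raw notebook carries a `*` token between the explicit `Max[…]` and the first remainder; read as `+`
(the engines' `corrected-open-polygons` variant, [FvdH17-II] §4) — with the derivable open counts of §21 (OpenTriangle
one-tail `C(M−m+1,2)`, OpenSquare two- and three-tail `C(M−m+1,2)` / `M−m`, `M = CS+1`) and `CS` in place of the literal
`10`s of the open square (DIVERGENCE D26).  By `Stage1OpenBranchD11` (lean2-g13 module 4) the K-branch is the selected
minimum of every open triangle / square instance at the `d = 11` record once the token is read additively, so the open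
counts are value-neutral there; they are set to the derivable ones for the TEXT's sake.

  `U.triangle m k = Σ_j C(j+1−m)C(j+2−m)/2 · baw_j · zsh j k + C(R+1−m)·C(R−m)/2 · X₁ + (R+1−m) · X₂ + X₃`,
  `U.square  m k = Σ_j (…)/6 · baw_j · zsh j k + C(R+1−m)C(R+2−m)C(R+3−m)/6 · X₁ + C(R+1−m)·C(R−m)/2 · X₂ + (R−m) · X₃ + X₄`,
  `X_i := (2dz)^{R−k} VarGamma2^i I[i,R,{0}]`;
  `U.openTriangle m k = Min[(2dz)^{m−k} VarGamma2³ K[3,m,{1}], Max[S₂,S₁] + C(CS+2−m)C(CS+1−m)/2 · Y₁ + (CS+1−m) · Y₂ + Y₃]`,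
  `U.openSquare  m k = Min[(2dz)^{m−k} VarGamma2⁴ K[4,m,{1}], Max[S₂,S₁] + C(CS+1−m)C(CS+2−m)C(CS+3−m)/6 · Y₁
                        + C(CS+2−m)C(CS+1−m)/2 · Y₂ + (CS+1−m) · Y₃ + Y₄]`,  `Y_i := (2dz)^{CS+1−k} VarGamma2^{i∨…} K[i,CS+1,{1}]`
  (the `VarGamma2` exponents exactly as coded: `Y₁` carries one `VarGamma2`, as in the coded open triangle / square).

RE-BINDING.  The four cells live in the nested namespace `Stage1Cells.Rec.U` under the SAME NAMES `triangle`, `square`,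
`openTriangle`, `openSquare`; after them this file repeats, VERBATIM (text copied mechanically from `Stage1Cells.lean`,
sha256 5e6ef7a931fe3683…, generator `lean2/g13/utwin/gen_cells_u.py`, pattern of lean2-g12's `gen_cells_rec.py`), every cell of
`Stage1Cells` that depends on one of them — 60 definitions, `PS` … `XiIotaAbsD0` — so that inside `Stage1Cells.Rec.U`
each unqualified `triangle`, `C3`, `Xi1D`, … denotes the derivable-multiplicity cell, each unqualified `wb2`, `H1`, `hS`,
`Xi0D`, … (the 19 cells of the weighted-bubble closure that do not reach a polygon) denotes the RECORD-CLASS cell of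
`Stage1Cells.Rec` (`Stage1CellsRec.lean`, sha256 b27bcc23395e43b9…), and every other name (`bubble`, `openBubble`, `G13`, …) the
unchanged `Stage1Cells` cell.  32 of the copied cells (`C3`, `hi`, …, the ones reaching BOTH a polygon and a weighted
bubble) shadow their `Stage1Cells.Rec` namesakes.  Hence `Rec.U.XiR1D`, `Rec.U.Xi2D`, `Rec.U.XiOddD`, … are the cells
18–43 of the notebook over the derivable-multiplicity polygons AND the weighted bubble of record, i.e. the typed text of
the engines' record class `U` on the cell of record (`wborbx + wbg2`; `hexprint` lives in the instantiating module).

ORDER.  Over non-negative valuations every `U` polygon dominates its coded namesake pointwise in the closed cells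
(`C(n+1,2) = C(n,2) + n`); for the open cells the coded D12 product can be on either side of the additive form in general
— at the `d = 11` record the coded open triangle is BELOW it at `m = 2, 3` (`Stage1OpenBranchD11`).  The instantiated
comparisons (ℚ mirror over these cells, `decide`d dominations) are tranche 2; the small companion
`MeanFieldD11Stage1URecord` (lean2-g13) already decides, at the certified `d = 11` record data, that each `U` closed cell
the table uses exceeds its coded namesake by exactly `n ·` (one tail unit) and that each `U` open cell the table uses
evaluates to its K-branch.

EPISTEMIC STATUS.  Definitions (typed text of a DERIVED recipe: the closed Triangle one-tail `C(n+1,2)` is PRINTED —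
[NoBLE17-I] (5.41) first form — the other corrected counts are derived by the printed method, LEMMAS §21 'EPISTEMIC
CLASS'); the x-space extraction theorems that make the multiplicity table a theorem are node N68c-X (lit seats), not
this file.  No dimension sentence of the packet is touched (VERDICT-D10 NO; `MeanFieldD11Cert` rev 6 is the record).

[cite: FitznerVanDerHofstad2016NoBLE, §5.3 (5.40)–(5.42) (PTRF 169 p. 1098; arXiv:1506.07969 TeX l.3136–3175)]
[cite: FitznerVanDerHofstad2017, notebook Percolation.nb cells 11–12 (transcript l.389–461)]
-/

namespace Literature.Probability.FitznerVanDerHofstad2017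
namespace Stage1Cells
namespace Rec
namespace U

open NoGoFrame (Pt)
open PX

section Cells

variable (P : Params)

/-! ## Cells 11–12 with the derivable multiplicities (LEMMAS §21) -/

/-- Cell 11, derivable-multiplicity class (`tri1`): `Bound[Triangle,m,s]/(2dz)^k` with the ONE-tail count `C(R+1−m,2)`
([NoBLE17-I] (5.41) first form; the notebook codes `C(R−m,2)`), the coded two-tail `R+1−m` and three-tail `1` kept.
[cite: FitznerVanDerHofstad2016NoBLE, (5.41) first form (PTRF 169 p. 1098)] -/
def triangle (m k : ℕ) : T :=
  sumR m P.E (fun j => C (j + 1 - m) * C (j + 2 - m) * tab (.baw j .v0) * zsh P j k /ₙ 2)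
    + C (P.R + 1 - m) * C (P.R - m) * w P ^ (P.R - k) * Vg * tab (.I 1 P.R .v0) /ₙ 2
    + C (P.R + 1 - m) * w P ^ (P.R - k) * Vg ^ 2 * tab (.I 2 P.R .v0)
    + w P ^ (P.R - k) * Vg ^ 3 * tab (.I 3 P.R .v0)

/-- Cell 11, derivable-multiplicity class (`sq2`): `Bound[Square,m,s]/(2dz)^k` with the TWO-tail count `C(R+1−m,2)` (the
notebook codes `C(R−m,2)`), the coded one-tail `C(R+3−m,3)`, three-tail `R−m` and four-tail `1` kept. [folklore] -/
def square (m k : ℕ) : T :=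
  sumR m P.E (fun j => C (j + 1 - m) * C (j + 2 - m) * C (j + 3 - m) * tab (.baw j .v0) * zsh P j k /ₙ 6)
    + C (P.R + 1 - m) * C (P.R + 2 - m) * C (P.R + 3 - m) * w P ^ (P.R - k) * Vg * tab (.I 1 P.R .v0) /ₙ 6
    + C (P.R + 1 - m) * C (P.R - m) * w P ^ (P.R - k) * Vg ^ 2 * tab (.I 2 P.R .v0) /ₙ 2
    + C (P.R - m) * w P ^ (P.R - k) * Vg ^ 3 * tab (.I 3 P.R .v0)
    + w P ^ (P.R - k) * Vg ^ 4 * tab (.I 4 P.R .v0)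

/-- Cell 12, additive form with the derivable open counts: `Bound[OpenTriangle,m,s]/(2dz)^k = Min[(2dz)^{m−k} VarGamma2³
K[3,m,{1}], Max[Σ_j C(j+1−m)C(j+2−m)/2 z^j nrBAW[j,d,{2}], same {1}] + C(CS+2−m)C(CS+1−m)/2 (2dz)^{CS+1−k} VarGamma2
K[1,CS+1,{1}] + (CS+1−m)(2dz)^{CS+1−k} VarGamma2² K[2,CS+1,{1}] + (2dz)^{CS+1−k} VarGamma2³ K[3,CS+1,{1}]]` (D12 token read
`+`; one-tail `C(M−m+1,2)`, `M = CS+1`). [folklore] -/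
def openTriangle (m k : ℕ) : T :=
  min (w P ^ (m - k) * Vg ^ 3 * tab (.K 3 m .v1))
    (max (sumR m P.CS fun j => C (j + 1 - m) * C (j + 2 - m) * z ^ j * tab (.baw j .v2) /ₙ 2)
         (sumR m P.CS fun j => C (j + 1 - m) * C (j + 2 - m) * z ^ j * tab (.baw j .v1) /ₙ 2)
      + C (P.CS + 2 - m) * C (P.CS + 1 - m) * w P ^ (P.CS + 1 - k) * Vg * tab (.K 1 (P.CS + 1) .v1) /ₙ 2
      + C (P.CS + 1 - m) * w P ^ (P.CS + 1 - k) * Vg ^ 2 * tab (.K 2 (P.CS + 1) .v1)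
      + w P ^ (P.CS + 1 - k) * Vg ^ 3 * tab (.K 3 (P.CS + 1) .v1))

/-- Cell 12, additive form with the derivable open counts and `CS` for the literal `10`s (D26): `Bound[OpenSquare,m,s]/(2dz)^k
= Min[(2dz)^{m−k} VarGamma2⁴ K[4,m,{1}], Max[…] + C(CS+1−m)C(CS+2−m)C(CS+3−m)/6 · Y₁ + C(CS+2−m)C(CS+1−m)/2 · Y₂ + (CS+1−m) ·
Y₃ + Y₄]` (two- and three-tail `C(M−m+1,2)` / `M−m`, `M = CS+1`). [folklore] -/
def openSquare (m k : ℕ) : T :=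
  min (w P ^ (m - k) * Vg ^ 4 * tab (.K 4 m .v1))
    (max (sumR m P.CS fun j => C (j + 1 - m) * C (j + 2 - m) * C (j + 3 - m) * z ^ j * tab (.baw j .v2) /ₙ 6)
         (sumR m P.CS fun j => C (j + 1 - m) * C (j + 2 - m) * C (j + 3 - m) * z ^ j * tab (.baw j .v1) /ₙ 6)
      + C (P.CS + 1 - m) * C (P.CS + 2 - m) * C (P.CS + 3 - m) * w P ^ (P.CS + 1 - k) * Vg * tab (.K 1 (P.CS + 1) .v1) /ₙ 6
      + C (P.CS + 2 - m) * C (P.CS + 1 - m) * w P ^ (P.CS + 1 - k) * Vg ^ 2 * tab (.K 2 (P.CS + 1) .v1) /ₙ 2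
      + C (P.CS + 1 - m) * w P ^ (P.CS + 1 - k) * Vg ^ 3 * tab (.K 3 (P.CS + 1) .v1)
      + w P ^ (P.CS + 1 - k) * Vg ^ 4 * tab (.K 4 (P.CS + 1) .v1))

/-! ## Cells 18–43 over the derivable-multiplicity polygons (verbatim copies of `Stage1Cells`, re-bound) -/

/-! ## Cells 16–17: the vectors `P^S`, `P^E`, `P^ι` -/

/-- (derivable-multiplicity class: re-bound copy of `Stage1Cells.PS` over the `Rec.U` polygons) Cell 16: `Bound[PS,a,s]` = `(1 + ½B₂, Loop₄ + B₃, T₄ + ½B₂)`. [cite: FitznerVanDerHofstad2017, notebook Percolation.nb cell 16 (transcript l.527–534)] -/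
def PS : Vec := ![1 + bubble P 2 0 /ₙ 2, Loop4 P + bubble P 3 0, triangle P 4 0 + bubble P 2 0 /ₙ 2]

/-- (derivable-multiplicity class: re-bound copy of `Stage1Cells.PE` over the `Rec.U` polygons) Cell 16: `Bound[PE,a,s]` = `(1 + ½B₂, B₃, T₄)`. [cite: FitznerVanDerHofstad2017, notebook Percolation.nb cell 16 (transcript l.527–534)] -/
def PE : Vec := ![1 + bubble P 2 0 /ₙ 2, bubble P 3 0, triangle P 4 0]

/-- (derivable-multiplicity class: re-bound copy of `Stage1Cells.PSNT` over the `Rec.U` polygons) Cell 29 (`Vector[PSNT,s]`; Input cell 28 is empty): `PSNT = PS − (1,0,0)` in reduced form (M6a). [cite: FitznerVanDerHofstad2017, notebook Percolation.nb cell 29 (transcript l.829–857)] -/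
def PSNT : Vec := ![bubble P 2 0 /ₙ 2, Loop4 P + bubble P 3 0, triangle P 4 0 + bubble P 2 0 /ₙ 2]

/-- (derivable-multiplicity class: re-bound copy of `Stage1Cells.PENT` over the `Rec.U` polygons) Cell 29 (`Vector[PENT,s]`; Input cell 28 is empty): `PENT = PE − (1,0,0)` in reduced form (M6a). [cite: FitznerVanDerHofstad2017, notebook Percolation.nb cell 29 (transcript l.829–857)] -/
def PENT : Vec := ![bubble P 2 0 /ₙ 2, bubble P 3 0, triangle P 4 0]

/-- (derivable-multiplicity class: re-bound copy of `Stage1Cells.Piota` over the `Rec.U` polygons) Cell 17: `Bound[Piota,a,s]`. [cite: FitznerVanDerHofstad2017, notebook Percolation.nb cell 17 (transcript l.543–547)] -/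
def Piota : Vec :=
  ![C 1 /ₙ (2 * P.d) + G13 P * (1 + bubble P 2 0 /ₙ 2),
    G13 P * (1 + PS P 1),
    G13 P * PS P 2 + G13 P + bubble P 4 1 + (G13 P + bubble P 3 1) * (C 1 /ₙ 2) * bubble P 2 0]

/-! ## Cells 18–24: the matrices -/

/-- (derivable-multiplicity class: re-bound copy of `Stage1Cells.A` over the `Rec.U` polygons) Cell 18: `Bound[A,a,b,s]` (and, by cell 29 AS CODED, also `Matrix[ANonRep]`: HOME/DIVERGENCE.md D16).
[cite: FitznerVanDerHofstad2017, notebook Percolation.nb cells 18, 29 (transcript l.559–580, l.829–857)] -/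
def A : Mat :=
  !![bubble P 2 0 /ₙ 2, bubble P 3 0, triangle P 4 0;
     bubble P 3 1, bubble P 3 1, triangle P 4 1;
     openBubble P 1 0, openBubble P 2 0, openTriangle P 3 0]

/-- (derivable-multiplicity class: re-bound copy of `Stage1Cells.Aiota` over the `Rec.U` polygons) Cell 19: `Bound[Aiota,a,b,s]`. [cite: FitznerVanDerHofstad2017, notebook Percolation.nb cell 19 (transcript l.592–612)] -/
def Aiota : Mat :=
  !![bubble P 3 0, bubble P 3 0, triangle P 4 0;
     bubble P 3 1, bubble P 3 1, triangle P 3 1;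
     openBubble P 2 0, openBubble P 2 0, openTriangle P 3 0]

/-- (derivable-multiplicity class: re-bound copy of `Stage1Cells.B2i` over the `Rec.U` polygons) Cell 21: `Bound[B2i,a,b,s]` (only column 2 is non-zero). [cite: FitznerVanDerHofstad2017, notebook Percolation.nb cell 21 (transcript l.649–657)] -/
def B2i : Mat :=
  !![0, 0, bubble P 3 1 * triangle P 4 0 + triangle P 4 0 * openTriangle P 3 0;
     0, 0, bubble P 3 1 * triangle P 4 1 + triangle P 4 1 * openTriangle P 3 0;
     0, 0, bubble P 3 1 * openTriangle P 3 0 + openBubble P 2 0 * openTriangle P 4 0]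

/-- (derivable-multiplicity class: re-bound copy of `Stage1Cells.Bbar2i` over the `Rec.U` polygons) Cell 22: `Bound[Bbar2i,a,b,s]`. [cite: FitznerVanDerHofstad2017, notebook Percolation.nb cell 22 (transcript l.666–676)] -/
def Bbar2i : Mat :=
  !![0, 0, 0;
     bubble P 2 0 /ₙ 2 * openTriangle P 3 0, bubble P 2 1 /ₙ 2 * openTriangle P 3 0, bubble P 2 0 /ₙ 2 * Gmax1 P ^ 2;
     bubble P 2 0 /ₙ 2 * openTriangle P 4 0 + bubble P 3 1 * triangle P 4 0 + triangle P 4 0 * openTriangle P 3 0,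
       bubble P 2 1 /ₙ 2 * openTriangle P 4 0 + bubble P 3 2 * triangle P 4 0 + triangle P 4 1 * openTriangle P 3 0,
       bubble P 2 0 /ₙ 2 * Gmax1 P * openBubble P 2 0 + openTriangle P 3 0 * bubble P 3 1
         + Gmax1 P * openBubble P 1 0 * triangle P 4 0]

/-- (derivable-multiplicity class: re-bound copy of `Stage1Cells.C3` over the `Rec.U` polygons and the `Rec` weighted bubbles) Cell 24: `Bound[C3,a,b,s]`. [cite: FitznerVanDerHofstad2017, notebook Percolation.nb cell 24 (transcript l.758–769)] -/
def C3 : Mat :=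
  !![wol0 * openTriangle P 3 0 * square P 4 0 + wb1 P 0 * openBubble P 2 0 * triangle P 3 0,
       wol0 * openTriangle P 3 1 * square P 4 0 + wb1 P 0 * openBubble P 2 1 * triangle P 3 0,
       wol0 * openTriangle P 3 0 * openSquare P 3 0 + wb1 P 0 * w P * Vg ^ 2 * mx24 * triangle P 3 0;
     wol0 * openTriangle P 3 1 * square P 4 0 + wb1 P 0 * openBubble P 2 0 * triangle P 3 1,
       wol0 * openTriangle P 3 1 * square P 4 1 + wb1 P 0 * openBubble P 2 1 * triangle P 3 1,
       wol0 * w P ^ 2 * Vg ^ 3 * tab (.I 3 2 .v0) * square P 4 1 + wb1 P 0 * w P * Vg ^ 2 * mx24 * triangle P 4 1;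
     wol0 * openTriangle P 3 0 * openSquare P 3 0 + wb1 P 0 * openBubble P 2 0 * openTriangle P 2 0,
       wol0 * w P ^ 2 * Vg ^ 3 * tab (.I 3 2 .v0) * square P 4 1 + wb1 P 0 * openBubble P 2 1 * openTriangle P 2 0,
       wol0 * w P ^ 2 * Vg ^ 3 * tab (.I 3 2 .v0) * openSquare P 3 0 + wb1 P 0 * w P * Vg ^ 2 * mx24 * openTriangle P 2 0]

/-! ## Cells 26–31: `h^ι`, `h^{ιι}`, `B`, `B̄`, `C₁`, `C₂` -/

/-- (derivable-multiplicity class: re-bound copy of `Stage1Cells.hiP2` over the `Rec.U` polygons and the `Rec` weighted bubbles) Cell 26: `Bound[hi,part2,b,s]` (with `AiotaNonRep`, `AiotabarNonRep`), `Σ_a PS_a H2_{ab} − H2_{0b} = PSNT.H2_{·b}` (M6a). [cite: FitznerVanDerHofstad2017, notebook Percolation.nb cell 26 (transcript l.787–800)] -/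
def hiP2 (b : Fin 3) : T :=
  G13 P * H2 P 0 b + C 2 * G13 P * vecMul (PSNT P) (H2 P) b
    + C 2 * G13 P *
      (wb1 P 0 /ₙ 2 * AiotaNR P b 0 + wb1 P 1 * AiotaNR P b 1
        + min (min (wob P 0 0 * AiotaNR P b 2) (wob P 1 0 * AiotaNR P b 2 + wb1 P 0 /ₙ 2 * AiotabarNR P b 2))
            (wob P 1 0 * AiotaNR P b 2 + wol0 /ₙ 2 * AiotaNR P b 2))

/-- (derivable-multiplicity class: re-bound copy of `Stage1Cells.hi` over the `Rec.U` polygons and the `Rec` weighted bubbles) Cell 26: `Bound[hi,b,s] = part1 + part2 + part3`. [cite: FitznerVanDerHofstad2017, notebook Percolation.nb cell 26 (transcript l.787–800)] -/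
def hi : Vec := fun b => hiP1 P b + hiP2 P b + hiP3 P b

/-- (derivable-multiplicity class: re-bound copy of `Stage1Cells.hII` over the `Rec.U` polygons and the `Rec` weighted bubbles) Cell 27: `Bound[hII,b,s] = hi_b + 2 Σ_a (hi_a AiotaNonRep_{ab} + Σ_c Piota_a AiotaNonRep_{ac} H2_{cb})`.
[cite: FitznerVanDerHofstad2017, notebook Percolation.nb cell 27 (transcript l.809–813)] -/
def hII : Vec := fun b =>
  hi P b + C 2 * sumL [(0 : Fin 3), 1, 2] (fun a =>
    hi P a * AiotaNR P a b + sumL [(0 : Fin 3), 1, 2] (fun c => Piota P a * AiotaNR P a c * H2 P c b))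

/-- (derivable-multiplicity class: re-bound copy of `Stage1Cells.B` over the `Rec.U` polygons) Cell 30: `B = AiotaNonRep.A + Aiota PS₀ + B2i`. [cite: FitznerVanDerHofstad2017, notebook Percolation.nb cell 30 (transcript l.869–872)] -/
def B : Mat := madd (madd (matMul (AiotaNR P) (A P)) (smul (PS P 0) (Aiota P))) (B2i P)

/-- (derivable-multiplicity class: re-bound copy of `Stage1Cells.Bbar` over the `Rec.U` polygons) Cell 30: `Bbar = Aiota.ANonRep + Aiota + Bbar2i` (`ANonRep = A` as coded, D16). [cite: FitznerVanDerHofstad2017, notebook Percolation.nb cell 30 (transcript l.869–872)] -/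
def Bbar : Mat := madd (madd (matMul (Aiota P) (A P)) (Aiota P)) (Bbar2i P)

/-- (derivable-multiplicity class: re-bound copy of `Stage1Cells.C1` over the `Rec.U` polygons and the `Rec` weighted bubbles) Cell 31: `C1 = (2 H2.A + 2 AiotaNonRep.H1 + H2).Aiota + H2.Bbar2i`. [cite: FitznerVanDerHofstad2017, notebook Percolation.nb cell 31 (transcript l.884–888)] -/
def C1 : Mat :=
  madd (matMul (madd (madd (smul 2 (matMul (H2 P) (A P))) (smul 2 (matMul (AiotaNR P) (H1 P)))) (H2 P)) (Aiota P))
    (matMul (H2 P) (Bbar2i P))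

/-- (derivable-multiplicity class: re-bound copy of `Stage1Cells.C2` over the `Rec.U` polygons and the `Rec` weighted bubbles) Cell 31: `C2 = (2 H3.A + 2 AiotaNonRep.H1 + H3).Aiota + 2 C3 + H3.Bbar2i`. [cite: FitznerVanDerHofstad2017, notebook Percolation.nb cell 31 (transcript l.884–888)] -/
def C2 : Mat :=
  madd (madd (matMul (madd (madd (smul 2 (matMul (H3 P) (A P))) (smul 2 (matMul (AiotaNR P) (H1 P)))) (H3 P)) (Aiota P))
    (smul 2 (C3 P))) (matMul (H3 P) (Bbar2i P))

/-- (derivable-multiplicity class: re-bound copy of `Stage1Cells.BminusAiota` over the `Rec.U` polygons) Cell 40: `B − Aiota` in reduced form (M6a): `AiotaNonRep.A + ½B₂ Aiota + B2i` (`PS₀ = 1 + ½B₂`). [cite: FitznerVanDerHofstad2017, notebook Percolation.nb cell 40 (transcript l.1109–1113)] -/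
def BminusAiota : Mat := madd (madd (matMul (AiotaNR P) (A P)) (smul (bubble P 2 0 /ₙ 2) (Aiota P))) (B2i P)

/-- (derivable-multiplicity class: re-bound copy of `Stage1Cells.C1minusH2Aiota` over the `Rec.U` polygons and the `Rec` weighted bubbles) Cell 40: `C1 − H2.Aiota` in reduced form (M6a): `(2 H2.A + 2 AiotaNonRep.H1).Aiota + H2.Bbar2i`. [cite: FitznerVanDerHofstad2017, notebook Percolation.nb cell 40 (transcript l.1109–1113)] -/
def C1minusH2Aiota : Mat :=
  madd (matMul (madd (smul 2 (matMul (H2 P) (A P))) (smul 2 (matMul (AiotaNR P) (H1 P)))) (Aiota P))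
    (matMul (H2 P) (Bbar2i P))

/-! ## Cells 33–35: `N = 0, 1` -/

/-- (derivable-multiplicity class: re-bound copy of `Stage1Cells.Xi1` over the `Rec.U` polygons) Cell 35: `Bound[Xi,1,s] = PS.AiotaBar.PE`. [cite: FitznerVanDerHofstad2017, notebook Percolation.nb cell 35 (transcript l.980–1004)] -/
def Xi1 : T := dot (vecMul (PS P) (AiotaBar P)) (PE P)

/-- (derivable-multiplicity class: re-bound copy of `Stage1Cells.Xi1red` over the `Rec.U` polygons) Cell 35: `PS.AiotaBar.PE − AiotaBar₀₀` in reduced form (M6a): `(AiotaBar.PENT)₀ + (PSNT.AiotaBar)₀ + PSNT.AiotaBar.PENT`.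
[cite: FitznerVanDerHofstad2017, notebook Percolation.nb cell 35] -/
def Xi1red : T :=
  mulVec (AiotaBar P) (PENT P) 0 + vecMul (PSNT P) (AiotaBar P) 0 + dot (vecMul (PSNT P) (AiotaBar P)) (PENT P)

/-- (derivable-multiplicity class: re-bound copy of `Stage1Cells.XiR1` over the `Rec.U` polygons) Cell 35: `Bound[Xi,R,1,s] = PS.AiotaBar.PE − AiotaBar₀₀ + B₄`.
[cite: FitznerVanDerHofstad2017, notebook Percolation.nb cell 35] -/
def XiR1 : T := Xi1red P + bubble P 4 0

/-- (derivable-multiplicity class: re-bound copy of `Stage1Cells.PsiRI1` over the `Rec.U` polygons) Cell 35: `Bound[Psi,RI,1,s] = ((2d−1)/(2d)) mubOverMu (PS.AiotaBar.PE − AiotaBar₀₀ + (2d−2) z G₁₃ + B₄)`.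
[cite: FitznerVanDerHofstad2017, notebook Percolation.nb cell 35] -/
def PsiRI1 : T :=
  C (2 * P.d - 1) * mubOverMu * (Xi1red P + C (2 * P.d - 2) * z * G13 P + bubble P 4 0) /ₙ (2 * P.d)

/-- (derivable-multiplicity class: re-bound copy of `Stage1Cells.PsiRII1` over the `Rec.U` polygons) Cell 35: `Bound[Psi,RII,1,s] = ((2d−1)/(2d)) mubOverMu (PS.AiotaBar.PE − AiotaBar₀₀ + B₄)`.
[cite: FitznerVanDerHofstad2017, notebook Percolation.nb cell 35] -/
def PsiRII1 : T := C (2 * P.d - 1) * mubOverMu * (Xi1red P + bubble P 4 0) /ₙ (2 * P.d)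

/-- (derivable-multiplicity class: re-bound copy of `Stage1Cells.betatmp` over the `Rec.U` polygons and the `Rec` weighted bubbles) Cell 35: `betatmp`. [cite: FitznerVanDerHofstad2017, notebook Percolation.nb cell 35 (transcript l.980–1004)] -/
def betatmp : T :=
  H3 P 0 0 + C 2 * (bubble P 2 0 /ₙ 2 * wb2 P 0 + wb1 P 0 /ₙ 2 * bubble P 3 0) + bubble P 2 0 /ₙ 2 * wob P 2 0
    + C 4 * wb3 P 1 * bubble P 3 0 + C 4 * wob P 2 1 * bubble P 4 0 + C 4 * wob P 2 0 * triangle P 4 0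
    + C 4 * wob P 1 0 * triangle P 5 0
    + C 3 * dot (vecMul (hS P) (tr (Aiota P))) (PENT P) + C 3 * dot (vecMul (PSNT P) (H3 P)) (PENT P)
    + C 3 * dot (vecMul (PSNT P) (Aiota P)) (hE P)

/-- (derivable-multiplicity class: re-bound copy of `Stage1Cells.Xi1D` over the `Rec.U` polygons and the `Rec` weighted bubbles) Cell 35: `Bound[Xi,1,Delta,s] = betatmp`. [cite: FitznerVanDerHofstad2017, notebook Percolation.nb cell 35] -/
def Xi1D : T := betatmp P

/-- (derivable-multiplicity class: re-bound copy of `Stage1Cells.XiR1D` over the `Rec.U` polygons and the `Rec` weighted bubbles) Cell 35: `Bound[Xi,R,1,Delta,s] = betatmp − H2₀₀ + WB₂ = betatmp` (exact cancellation `H2₀₀ = WB₂`, M6a).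
[cite: FitznerVanDerHofstad2017, notebook Percolation.nb cell 35] -/
def XiR1D : T := betatmp P

/-- (derivable-multiplicity class: re-bound copy of `Stage1Cells.PsiRI1D` over the `Rec.U` polygons and the `Rec` weighted bubbles) Cell 35: `Bound[Psi,RI,1,Delta,s] = mubOverMu (betatmp + Xi₁)`.
[cite: FitznerVanDerHofstad2017, notebook Percolation.nb cell 35] -/
def PsiRI1D : T := mubOverMu * (betatmp P + Xi1 P)

/-- (derivable-multiplicity class: re-bound copy of `Stage1Cells.PsiRII1D` over the `Rec.U` polygons and the `Rec` weighted bubbles) Cell 35: `Bound[Psi,RII,1,Delta,s] = mubOverMu (betatmp − H2₀₀ + WB₂) = mubOverMu betatmp`.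
[cite: FitznerVanDerHofstad2017, notebook Percolation.nb cell 35] -/
def PsiRII1D : T := mubOverMu * betatmp P

/-- (derivable-multiplicity class: re-bound copy of `Stage1Cells.XiIota1` over the `Rec.U` polygons) Cell 35: `Bound[XiIota,1,s] = Piota.AiotaBar.PE`.
[cite: FitznerVanDerHofstad2017, notebook Percolation.nb cell 35] -/
def XiIota1 : T := dot (vecMul (Piota P) (AiotaBar P)) (PE P)

/-- (derivable-multiplicity class: re-bound copy of `Stage1Cells.XiIota1Dei` over the `Rec.U` polygons and the `Rec` weighted bubbles) Cell 35: `Bound[XiIota,1,Delta,ei,s] = hi₀ + 2 hi.PENT + 2 (Piota.Aiota).hE − hi₀ PENT₀ − (Piota.Aiota)₀ hE₀` in reduced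
form (M6a): `hi₀ + hi₀ PENT₀ + 2 Σ_{b≥1} hi_b PENT_b + (Piota.Aiota)₀ hE₀ + 2 Σ_{b≥1} (Piota.Aiota)_b hE_b`.
[cite: FitznerVanDerHofstad2017, notebook Percolation.nb cell 35] -/
def XiIota1Dei : T :=
  hi P 0 + hi P 0 * PENT P 0 + C 2 * (hi P 1 * PENT P 1 + hi P 2 * PENT P 2)
    + vecMul (Piota P) (Aiota P) 0 * hE P 0
    + C 2 * (vecMul (Piota P) (Aiota P) 1 * hE P 1 + vecMul (Piota P) (Aiota P) 2 * hE P 2)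

/-- (derivable-multiplicity class: re-bound copy of `Stage1Cells.XiIota1D0` over the `Rec.U` polygons and the `Rec` weighted bubbles) Cell 35: `Bound[XiIota,1,Delta,0,s] = 2 XiIota₁Δei + 2 XiIota₁`.
[cite: FitznerVanDerHofstad2017, notebook Percolation.nb cell 35] -/
def XiIota1D0 : T := C 2 * XiIota1Dei P + C 2 * XiIota1 P

/-! ## Cells 38–40: `N = 2, 3` (the `EvenTail`/`OddTail` cells 41–42 are replaced by these first terms, `T″₀`) -/

/-- (derivable-multiplicity class: re-bound copy of `Stage1Cells.Xi2` over the `Rec.U` polygons) Cell 38: `Bound[Xi,2,s] = PS.B.AiotaBar.PE`. [cite: FitznerVanDerHofstad2017, notebook Percolation.nb cell 38 (transcript l.1067–1084)] -/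
def Xi2 : T := dot (vecMul (vecMul (PS P) (B P)) (AiotaBar P)) (PE P)

/-- (derivable-multiplicity class: re-bound copy of `Stage1Cells.XiIota2` over the `Rec.U` polygons) Cell 38: `Bound[XiIota,2,s] = Piota.B.AiotaBar.PE`.
[cite: FitznerVanDerHofstad2017, notebook Percolation.nb cell 38] -/
def XiIota2 : T := dot (vecMul (vecMul (Piota P) (B P)) (AiotaBar P)) (PE P)

/-- (derivable-multiplicity class: re-bound copy of `Stage1Cells.Xi3` over the `Rec.U` polygons) Cell 38: `Bound[Xi,3,s] = PS.B.B.AiotaBar.PE`.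
[cite: FitznerVanDerHofstad2017, notebook Percolation.nb cell 38] -/
def Xi3 : T := dot (vecMul (vecMul (vecMul (PS P) (B P)) (B P)) (AiotaBar P)) (PE P)

/-- (derivable-multiplicity class: re-bound copy of `Stage1Cells.XiIota3` over the `Rec.U` polygons) Cell 38: `Bound[XiIota,3,s] = Piota.B.B.AiotaBar.PE`.
[cite: FitznerVanDerHofstad2017, notebook Percolation.nb cell 38] -/
def XiIota3 : T := dot (vecMul (vecMul (vecMul (Piota P) (B P)) (B P)) (AiotaBar P)) (PE P)

/-- (derivable-multiplicity class: re-bound copy of `Stage1Cells.C1BbarBC2` over the `Rec.U` polygons and the `Rec` weighted bubbles) `C1.Bbar + B.C2` (cells 38, 40). [cite: FitznerVanDerHofstad2017, notebook Percolation.nb cell 38] -/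
def C1BbarBC2 : Mat := madd (matMul (C1 P) (Bbar P)) (matMul (B P) (C2 P))

/-- (derivable-multiplicity class: re-bound copy of `Stage1Cells.H2PENTAhE` over the `Rec.U` polygons and the `Rec` weighted bubbles) `H2.PENT + Aiota.hE` (cells 38, 40). [cite: FitznerVanDerHofstad2017, notebook Percolation.nb cell 38] -/
def H2PENTAhE : Vec := vadd (mulVec (H2 P) (PENT P)) (mulVec (Aiota P) (hE P))

/-- (derivable-multiplicity class: re-bound copy of `Stage1Cells.hSAt` over the `Rec.U` polygons and the `Rec` weighted bubbles) `hS.Transpose[Aiota]` (cells 38, 40). [cite: FitznerVanDerHofstad2017, notebook Percolation.nb cell 38] -/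
def hSAt : Vec := vecMul (hS P) (tr (Aiota P))

/-- (derivable-multiplicity class: re-bound copy of `Stage1Cells.Xi3D` over the `Rec.U` polygons and the `Rec` weighted bubbles) Cell 38: `Bound[Xi,3,Delta,s]`. [cite: FitznerVanDerHofstad2017, notebook Percolation.nb cell 38] -/
def Xi3D : T :=
  C 3 * (dot (vecMul (vecMul (vecMul e0 (B P)) (B P)) (H3 P)) e0
          + dot (vecMul e0 (madd (matMul (B P) (C1 P)) (matMul (C2 P) (Bbar P)))) e0)
    + C 4 * (dot (vecMul (vecMul e0 (B P)) (B P)) (H2PENTAhE P) + dot (vecMul e0 (C1BbarBC2 P)) (PENT P))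
    + C 4 * (dot (vecMul (vecMul (hSAt P) (Bbar P)) (Bbar P)) e0 + dot (vecMul (vecMul (PSNT P) (B P)) (B P)) (mulVec (H2 P) e0)
          + dot (vecMul (PSNT P) (C1BbarBC2 P)) e0)
    + C 5 * (dot (vecMul (vecMul (hSAt P) (Bbar P)) (Bbar P)) (PENT P)
          + dot (vecMul (vecMul (PSNT P) (B P)) (B P)) (H2PENTAhE P) + dot (vecMul (PSNT P) (C1BbarBC2 P)) (PENT P))

/-- (derivable-multiplicity class: re-bound copy of `Stage1Cells.XiIota2Dei` over the `Rec.U` polygons and the `Rec` weighted bubbles) Cell 38: `Bound[XiIota,2,Delta,ei,s]`. [cite: FitznerVanDerHofstad2017, notebook Percolation.nb cell 38] -/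
def XiIota2Dei : T :=
  C 2 * (dot (vecMul (hII P) (Bbar P)) e0 + dot (vecMul (vecMul (Piota P) (B P)) (H3 P)) e0)
    + C 3 * (dot (vecMul (hII P) (Bbar P)) (PENT P)
          + dot (vecMul (Piota P) (B P)) (vadd (mulVec (H3 P) (PENT P)) (mulVec (Aiota P) (hE P))))

/-- (derivable-multiplicity class: re-bound copy of `Stage1Cells.XiIota3Dei` over the `Rec.U` polygons and the `Rec` weighted bubbles) Cell 38: `Bound[XiIota,3,Delta,ei,s]`. [cite: FitznerVanDerHofstad2017, notebook Percolation.nb cell 38] -/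
def XiIota3Dei : T :=
  C 3 * (dot (vecMul (vecMul (hII P) (Bbar P)) (Bbar P)) e0 + dot (vecMul (vecMul (vecMul (Piota P) (B P)) (B P)) (H2 P)) e0)
    + C 3 * dot (vecMul (vecMul (Piota P) (B P)) (C2 P)) e0
    + C 4 * (dot (vecMul (vecMul (hII P) (Bbar P)) (Bbar P)) (PENT P)
          + dot (vecMul (vecMul (Piota P) (B P)) (B P)) (H2PENTAhE P))
    + C 4 * dot (vecMul (vecMul (Piota P) (B P)) (C2 P)) (PENT P)

/-- (derivable-multiplicity class: re-bound copy of `Stage1Cells.XiIota2D0` over the `Rec.U` polygons and the `Rec` weighted bubbles) Cell 38: `Bound[XiIota,2,Delta,0,s]` (NB `Transpose[Aiota].hE` in the last term, as coded).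
[cite: FitznerVanDerHofstad2017, notebook Percolation.nb cell 38] -/
def XiIota2D0 : T :=
  C 3 * dot (vecMul (vecMul (Piota P) (B P)) (AiotaBar P)) e0 + C 4 * dot (vecMul (vecMul (Piota P) (B P)) (AiotaBar P)) (PENT P)
    + C 3 * (dot (vecMul (hII P) (Bbar P)) e0 + dot (vecMul (vecMul (Piota P) (B P)) (H3 P)) e0)
    + C 4 * (dot (vecMul (hII P) (Bbar P)) (PENT P)
          + dot (vecMul (Piota P) (B P)) (vadd (mulVec (H3 P) (PENT P)) (mulVec (tr (Aiota P)) (hE P))))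

/-- (derivable-multiplicity class: re-bound copy of `Stage1Cells.XiIota3D0` over the `Rec.U` polygons and the `Rec` weighted bubbles) Cell 38: `Bound[XiIota,3,Delta,0,s]`. [cite: FitznerVanDerHofstad2017, notebook Percolation.nb cell 38] -/
def XiIota3D0 : T :=
  C 4 * dot (vecMul (vecMul (vecMul (Piota P) (B P)) (B P)) (AiotaBar P)) e0
    + C 5 * dot (vecMul (vecMul (vecMul (Piota P) (B P)) (B P)) (AiotaBar P)) (PENT P)
    + C 4 * (dot (vecMul (vecMul (hII P) (Bbar P)) (Bbar P)) e0 + dot (vecMul (vecMul (vecMul (Piota P) (B P)) (B P)) (H2 P)) e0)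
    + C 4 * dot (vecMul (vecMul (Piota P) (B P)) (C2 P)) e0
    + C 5 * (dot (vecMul (vecMul (hII P) (Bbar P)) (Bbar P)) (PENT P)
          + dot (vecMul (vecMul (Piota P) (B P)) (B P)) (H2PENTAhE P))
    + C 5 * dot (vecMul (vecMul (Piota P) (B P)) (C2 P)) (PENT P)

/-- (derivable-multiplicity class: re-bound copy of `Stage1Cells.Xi2D` over the `Rec.U` polygons and the `Rec` weighted bubbles) Cell 40: `Bound[Xi,2,Delta,s]` with `B − Aiota`, `C1 − H2.Aiota` in reduced form (M6a). [cite: FitznerVanDerHofstad2017, notebook Percolation.nb cell 40 (transcript l.1109–1113)] -/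
def Xi2D : T :=
  C 2 * (dot (vecMul (vecMul e0 (BminusAiota P)) (H3 P)) e0 + dot (vecMul e0 (C1minusH2Aiota P)) e0)
    + (bubble P 3 0 * HdashN P 1 + bubble P 3 1 * HdashN P 2 + C 2 * bubble P 3 0 * wb2 P 0
        + C 2 * wb3 P 1 * bubble P 4 0 + C 2 * HdashA2 P 1 * bubble P 4 0 + C 2 * wob P 2 0 * triangle P 5 0
        + C 2 * HdashN P 1 * triangle P 5 0)
    + C 6 * (dot (vecMul (hSAt P) (Bbar P)) e0 + dot (vecMul (vecMul (PSNT P) (B P)) (H3 P)) e0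
          + dot (vecMul (PSNT P) (C1 P)) e0)
    + C 4 * (dot (vecMul (hSAt P) (Bbar P)) (PENT P)
          + dot (vecMul (PSNT P) (B P)) (vadd (mulVec (H3 P) (PENT P)) (mulVec (Aiota P) (hE P)))
          + dot (vecMul (PSNT P) (C1 P)) (PENT P))

/-! ## Cell 43: the aggregates (with `EvenTail := Bound[·,2,·]`, `OddTail := Bound[·,3,·]`, variant `T″₀`) -/

/-- (derivable-multiplicity class: re-bound copy of `Stage1Cells.XiEven` over the `Rec.U` polygons) Cell 43 (`T″₀`): `Bound[Xi,Even,s] = Xi₀ + Xi₂`. [cite: FitznerVanDerHofstad2017, notebook Percolation.nb cell 43 (transcript l.1182–1202)] -/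
def XiEven : T := Xi0 P + Xi2 P

/-- (derivable-multiplicity class: re-bound copy of `Stage1Cells.XiOdd` over the `Rec.U` polygons) Cell 43 (`T″₀`): `Bound[Xi,Odd,s] = Xi₁ + Xi₃`.
[cite: FitznerVanDerHofstad2017, notebook Percolation.nb cell 43] -/
def XiOdd : T := Xi1 P + Xi3 P

/-- (derivable-multiplicity class: re-bound copy of `Stage1Cells.XiAbs` over the `Rec.U` polygons) Cell 43: `Bound[Xi,Absolut,s] = Odd + Even`. [cite: FitznerVanDerHofstad2017, notebook Percolation.nb cell 43] -/
def XiAbs : T := XiOdd P + XiEven P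

/-- (derivable-multiplicity class: re-bound copy of `Stage1Cells.XiEvenD` over the `Rec.U` polygons and the `Rec` weighted bubbles) Cell 43 (`T″₀`): `Bound[Xi,Even,Delta,s] = Xi₀Δ + Xi₂Δ`.
[cite: FitznerVanDerHofstad2017, notebook Percolation.nb cell 43] -/
def XiEvenD : T := Xi0D P + Xi2D P

/-- (derivable-multiplicity class: re-bound copy of `Stage1Cells.XiOddD` over the `Rec.U` polygons and the `Rec` weighted bubbles) Cell 43 (`T″₀`): `Bound[Xi,Odd,Delta,s] = Xi₁Δ + Xi₃Δ`.
[cite: FitznerVanDerHofstad2017, notebook Percolation.nb cell 43] -/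
def XiOddD : T := Xi1D P + Xi3D P

/-- (derivable-multiplicity class: re-bound copy of `Stage1Cells.XiAbsD` over the `Rec.U` polygons and the `Rec` weighted bubbles) Cell 43: `Bound[Xi,Absolut,Delta,s]`. [cite: FitznerVanDerHofstad2017, notebook Percolation.nb cell 43] -/
def XiAbsD : T := XiOddD P + XiEvenD P

/-- (derivable-multiplicity class: re-bound copy of `Stage1Cells.XiIotaEven` over the `Rec.U` polygons) Cell 43 (`T″₀`): `Bound[XiIota,Even,s] = XiIota₀ + XiIota₂`.
[cite: FitznerVanDerHofstad2017, notebook Percolation.nb cell 43] -/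
def XiIotaEven : T := XiIota0 P + XiIota2 P

/-- (derivable-multiplicity class: re-bound copy of `Stage1Cells.XiIotaOdd` over the `Rec.U` polygons) Cell 43 (`T″₀`): `Bound[XiIota,Odd,s] = XiIota₁ + XiIota₃`.
[cite: FitznerVanDerHofstad2017, notebook Percolation.nb cell 43] -/
def XiIotaOdd : T := XiIota1 P + XiIota3 P

/-- (derivable-multiplicity class: re-bound copy of `Stage1Cells.XiIotaAbs` over the `Rec.U` polygons) Cell 43: `Bound[XiIota,Absolut,s]`. [cite: FitznerVanDerHofstad2017, notebook Percolation.nb cell 43] -/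
def XiIotaAbs : T := XiIotaOdd P + XiIotaEven P

/-- (derivable-multiplicity class: re-bound copy of `Stage1Cells.XiIotaEvenDei` over the `Rec.U` polygons and the `Rec` weighted bubbles) Cell 43 (`T″₀`): `Bound[XiIota,Even,Delta,ei,s]`.
[cite: FitznerVanDerHofstad2017, notebook Percolation.nb cell 43] -/
def XiIotaEvenDei : T := XiIota0Dei P + XiIota2Dei P

/-- (derivable-multiplicity class: re-bound copy of `Stage1Cells.XiIotaOddDei` over the `Rec.U` polygons and the `Rec` weighted bubbles) Cell 43 (`T″₀`): `Bound[XiIota,Odd,Delta,ei,s]`.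
[cite: FitznerVanDerHofstad2017, notebook Percolation.nb cell 43] -/
def XiIotaOddDei : T := XiIota1Dei P + XiIota3Dei P

/-- (derivable-multiplicity class: re-bound copy of `Stage1Cells.XiIotaAbsDei` over the `Rec.U` polygons and the `Rec` weighted bubbles) Cell 43: `Bound[XiIota,Absolut,Delta,ei,s]`. [cite: FitznerVanDerHofstad2017, notebook Percolation.nb cell 43] -/
def XiIotaAbsDei : T := XiIotaOddDei P + XiIotaEvenDei P

/-- (derivable-multiplicity class: re-bound copy of `Stage1Cells.XiIotaEvenD0` over the `Rec.U` polygons and the `Rec` weighted bubbles) Cell 43 (`T″₀`): `Bound[XiIota,Even,Delta,0,s]`.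
[cite: FitznerVanDerHofstad2017, notebook Percolation.nb cell 43] -/
def XiIotaEvenD0 : T := XiIota0D0 P + XiIota2D0 P

/-- (derivable-multiplicity class: re-bound copy of `Stage1Cells.XiIotaOddD0` over the `Rec.U` polygons and the `Rec` weighted bubbles) Cell 43 (`T″₀`): `Bound[XiIota,Odd,Delta,0,s]`.
[cite: FitznerVanDerHofstad2017, notebook Percolation.nb cell 43] -/
def XiIotaOddD0 : T := XiIota1D0 P + XiIota3D0 P

/-- (derivable-multiplicity class: re-bound copy of `Stage1Cells.XiIotaAbsD0` over the `Rec.U` polygons and the `Rec` weighted bubbles) Cell 43: `Bound[XiIota,Absolut,Delta,0,s]`. [cite: FitznerVanDerHofstad2017, notebook Percolation.nb cell 43] -/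
def XiIotaAbsD0 : T := XiIotaOddD0 P + XiIotaEvenD0 P

end Cells

end U
end Rec

end Stage1Cells
end Literature.Probability.FitznerVanDerHofstad2017
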